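import Literature.AlgebraicGeometry.HodgeTheory.AlgebraicMonodromyMumfordTate
import Literature.AlgebraicGeometry.HodgeTheory.TransvectionMonodromyZariskiDense
import HarnessLib

/-!
# The Zariski closure of a subgroup of `GL(V)` on `K`-points is a subgroup, and commutators of closure
# points lie in the closure of the commutators (Borel, *Linear Algebraic Groups*, I.1.7, I.2.1, I.2.4;
# CMSP Lemma–Definition 15.3.7)

Family `hodge`, layer `Literature/AlgebraicGeometry/HodgeTheory`. THEOREMS about the tree's `K`-points
Zariski closure `glZariskiClosure` (`AlgebraicMonodromyMumfordTate`; defined through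
`Motives.zariskiClosureEndOfBasis`: polynomials in the matrix entries). Companion of
`ZariskiClosureBaseChange` (descent, normal finite-index reduction, conjugation) and of
`TransvectionMonodromyZariskiDense` (`mul_mem_zariskiClosureEndOfBasis`: the closure of a multiplicative
set is multiplicative). Written by the prover seat `hodge-nonav-prover-Ax` (cell `hodge-nonav`) for the crux
K1 `VeryGeneralDeckCommutatorsInHg` of `Summits/HodgeConjecture/HodgeConjecture/Theses/CyclicUnitaryPowers.lean`
(planner memo STUB-PLAN-B2-g19 §1 (E1) "closure of a group is a group", (E2) "`⁅Zar Δ, Zar Δ⁆ ⊆ Zar ⁅Δ,Δ⁆`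
on `K`-points (conjugation/commutator with a fixed element is a polynomial map up to a power of `det`)",
§2 R5; and the "strip the central `U(1)`" step of the André cut, lane D of the registered skeleton v7).

The one idea (Borel I.1.7: `GL_n` is the principal open set `D(det)` of the affine space of matrices, with
coordinate ring `K[x_{ij}, 1/det]`): a point of the ENTRY-closure of `Δ ⊆ GL(V)` at which `det ≠ 0` also
satisfies every relation `Q(x, 1/det x) = 0`, `Q ∈ K[x_{ij}][y]`, satisfied on `Δ` — clear the denominator
by `det^N` (`eval_clearDenom_eq_zero_of_mem`). Since `x⁻¹ = adj(x)/det(x)` has entries in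
`K[x_{ij}, 1/det]`, every matrix expression `A · x · B · x⁻¹ · C` (fixed `A, B, C`) is such a rational map, and
closure membership pulls back along it (`eval_rationalConj_eq_zero_of_mem`).

## What is proved (any field `K`, `V` finite-dimensional)
* **`inv_mem_glZariskiClosure`**, `mul_mem_glZariskiClosure`, `one_mem_glZariskiClosure` — `Δ^Zar(K)` is a
  subgroup of `GL(V)` (Borel I.2.1 (a) with I.1.7); packaged as `glZariskiClosureSubgroup Δ` with
  `coe_glZariskiClosureSubgroup`.
* **`commutator_mem_glZariskiClosure`** — if `a c a⁻¹ c⁻¹ ∈ Δ` for all `a ∈ Δ₁`, `c ∈ Δ₂`, then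
  `g h g⁻¹ h⁻¹ ∈ Δ^Zar` for all `g ∈ Δ₁^Zar`, `h ∈ Δ₂^Zar` (the two-step argument, Borel I.2.4:
  `⁅Ā, B̄⁆ ⊆ closure of ⁅A, B⁆`); in particular `commutator_mem_glZariskiClosure_commutator`:
  `g, h ∈ Δ^Zar ⇒ g h g⁻¹ h⁻¹ ∈ (⁅Δ, Δ⁆)^Zar` (STUB-PLAN-B2 E2), and
  `commutator_mem_glZariskiClosure_of_mul_central`: commutators of points of the closure of `Δ·Z`, `Z`
  central, lie in `Δ^Zar` (the step "`U(h) ⊆ (Γ·U(1))^Zar ⇒ [U(h), U(h)] ⊆ Γ^Zar`" after Carlson–Toledo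
  §7, whose density theorem is stated modulo the centre).

## References
* [Borel1991] A. Borel, *Linear Algebraic Groups*, 2nd ed., GTM 126 (1991): I.1.7 (`GL_n = D(det)`,
  coordinate ring `K[x, 1/det]`), I.2.1 (closure of a subgroup is a subgroup), I.2.4 (commutator subgroups of
  closures).
* [CarlsonMullerStachPeters2017] J. Carlson, S. Müller-Stach, C. Peters, *Period Mappings and Period
  Domains*, 2nd ed. (2017), Lemma–Definition 15.3.7 ("`Γ^Zar` the smallest ℚ-algebraic subgroup containing
  `Γ`").
-/

noncomputable section

open Literature.AlgebraicGeometry.Motives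

namespace Literature.AlgebraicGeometry.HodgeTheory

/-! ### §1 Rational functions `Q(x, 1/det x)` on the entry-closure -/

section Rational

universe u v

variable {K : Type u} [Field K] {V : Type v} [AddCommGroup V] [Module K V]
variable {ι : Type*} [Fintype ι] [DecidableEq ι]

/-- Evaluation of `K[x_{ij}][y]` at a matrix `M` and `y = 1/det M`: the ring homomorphism
`Q ↦ Q(M, (det M)⁻¹)`. [cite: Borel1991, I.1.7] -/
def evalAtInvDet (M : Matrix ι ι K) : Polynomial (MvPolynomial (ι × ι) K) →+* K :=
  (Polynomial.evalRingHom (M.det)⁻¹).comp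
    (Polynomial.mapRingHom (MvPolynomial.eval fun ij : ι × ι => M ij.1 ij.2))

/-- [cite: Borel1991, I.1.7] -/
@[simp] theorem evalAtInvDet_C (M : Matrix ι ι K) (q : MvPolynomial (ι × ι) K) :
    evalAtInvDet M (Polynomial.C q) = MvPolynomial.eval (fun ij : ι × ι => M ij.1 ij.2) q := by
  simp [evalAtInvDet]

/-- [cite: Borel1991, I.1.7] -/
@[simp] theorem evalAtInvDet_X (M : Matrix ι ι K) :
    evalAtInvDet M (Polynomial.X : Polynomial (MvPolynomial (ι × ι) K)) = (M.det)⁻¹ := by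
  simp [evalAtInvDet]

/-- `evalAtInvDet M` restricted to the scalars `K` is the identity. [cite: Borel1991, I.1.7] -/
theorem evalAtInvDet_comp_algebraMap (M : Matrix ι ι K) :
    (evalAtInvDet M).comp (algebraMap K (Polynomial (MvPolynomial (ι × ι) K))) = RingHom.id K := by
  ext c
  rw [RingHom.comp_apply, Polynomial.algebraMap_apply, MvPolynomial.algebraMap_eq, evalAtInvDet_C,
    MvPolynomial.eval_C, RingHom.id_apply]

/-- Naturality: evaluating a substituted polynomial `P(m_{ij}(x, y))` at `(M, 1/det M)` is evaluating `P` at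
the values `m_{ij}(M, 1/det M)`. [cite: Borel1991, I.1.7] -/
theorem evalAtInvDet_aeval (M : Matrix ι ι K) {τ : Type*} (m : τ → Polynomial (MvPolynomial (ι × ι) K))
    (P : MvPolynomial τ K) :
    evalAtInvDet M (MvPolynomial.aeval m P) = MvPolynomial.eval (fun t => evalAtInvDet M (m t)) P := by
  rw [MvPolynomial.aeval_def, MvPolynomial.eval₂_comp_left (evalAtInvDet M), evalAtInvDet_comp_algebraMap]
  rfl

/-- The determinant as a polynomial in the entries evaluates to the determinant. [cite: Borel1991, I.1.7] -/
theorem eval_det_mvPolynomialX (M : Matrix ι ι K) :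
    MvPolynomial.eval (fun ij : ι × ι => M ij.1 ij.2) (Matrix.mvPolynomialX ι ι K).det = M.det := by
  rw [RingHom.map_det, Matrix.mvPolynomialX_mapMatrix_eval]

/-- **Clearing denominators** (`GL_n = D(det)`, Borel I.1.7): if `f` lies in the entry-closure of `S`, all
elements of `S` and `f` have invertible matrices, and a relation `Q(x, 1/det x) = 0`, `Q ∈ K[x_{ij}][y]`,
holds on `S`, then it holds at `f` — multiply by `det^{deg_y Q}` to get a polynomial relation in the entries.
[cite: Borel1991, I.1.7 and I.2.1] -/
theorem evalAtInvDet_eq_zero_of_mem (b : Module.Basis ι K V) {S : Set (Module.End K V)} {f : Module.End K V}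
    (hf : f ∈ zariskiClosureEndOfBasis b S) (hfdet : (LinearMap.toMatrix b b f).det ≠ 0)
    (hSdet : ∀ s ∈ S, (LinearMap.toMatrix b b s).det ≠ 0) (Q : Polynomial (MvPolynomial (ι × ι) K))
    (hQ : ∀ s ∈ S, evalAtInvDet (LinearMap.toMatrix b b s) Q = 0) :
    evalAtInvDet (LinearMap.toMatrix b b f) Q = 0 := by
  -- `Q̃ := Σ_k Q_k · det^{N-k}`, a polynomial in the entries with `Q̃(x) = det(x)^N · Q(x, 1/det x)`
  set N := Q.natDegree with hN
  let D : MvPolynomial (ι × ι) K := (Matrix.mvPolynomialX ι ι K).det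
  let Qt : MvPolynomial (ι × ι) K := ∑ k ∈ Finset.range (N + 1), Q.coeff k * D ^ (N - k)
  have key : ∀ M : Matrix ι ι K, M.det ≠ 0 →
      MvPolynomial.eval (fun ij : ι × ι => M ij.1 ij.2) Qt = M.det ^ N * evalAtInvDet M Q := by
    intro M hM
    have hdeg : (Q.map (MvPolynomial.eval fun ij : ι × ι => M ij.1 ij.2)).natDegree < N + 1 :=
      Nat.lt_succ_of_le (Polynomial.natDegree_map_le.trans le_rfl)
    rw [evalAtInvDet, RingHom.comp_apply, Polynomial.coe_mapRingHom, Polynomial.coe_evalRingHom,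
      Polynomial.eval_eq_sum_range' hdeg, Finset.mul_sum, map_sum]
    refine Finset.sum_congr rfl fun k hk => ?_
    have hkN : k ≤ N := Nat.lt_succ_iff.mp (Finset.mem_range.mp hk)
    rw [Polynomial.coeff_map, map_mul, map_pow, eval_det_mvPolynomialX, inv_pow, pow_sub₀ _ hM hkN]
    ring
  have hQt : ∀ s ∈ S, MvPolynomial.eval (fun ij : ι × ι => LinearMap.toMatrix b b s ij.1 ij.2) Qt = 0 := by
    intro s hs
    rw [key _ (hSdet s hs), hQ s hs, mul_zero]
  have h := hf Qt hQt
  rw [key _ hfdet] at h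
  exact (mul_eq_zero.mp h).resolve_left (pow_ne_zero _ hfdet)

/-! #### The generic matrix, constant matrices and the generic inverse in `K[x_{ij}][y]` -/

/-- The generic matrix `(x_{ij})` with entries in `K[x][y]`. [cite: Borel1991, I.1.7] -/
def genericMatrix (ι : Type*) (K : Type u) [Field K] [Fintype ι] [DecidableEq ι] :
    Matrix ι ι (Polynomial (MvPolynomial (ι × ι) K)) :=
  (Matrix.mvPolynomialX ι ι K).map Polynomial.C

/-- A constant matrix `A ∈ M_n(K)` seen in `M_n(K[x][y])`. [cite: Borel1991, I.1.7] -/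
def constMatrix (A : Matrix ι ι K) : Matrix ι ι (Polynomial (MvPolynomial (ι × ι) K)) :=
  A.map fun a => Polynomial.C (MvPolynomial.C a)

/-- The generic inverse `y · adj(x)` (`= x⁻¹` where `y = 1/det x`). [cite: Borel1991, I.1.7] -/
def genericInverse (ι : Type*) (K : Type u) [Field K] [Fintype ι] [DecidableEq ι] :
    Matrix ι ι (Polynomial (MvPolynomial (ι × ι) K)) :=
  (Polynomial.X : Polynomial (MvPolynomial (ι × ι) K)) • (genericMatrix ι K).adjugate

/-- The generic matrix evaluates to the matrix. [cite: Borel1991, I.1.7] -/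
theorem mapMatrix_genericMatrix (M : Matrix ι ι K) : (evalAtInvDet M).mapMatrix (genericMatrix ι K) = M := by
  ext i j
  simp [genericMatrix, Matrix.mvPolynomialX_apply]

/-- Constant matrices evaluate to themselves. [cite: Borel1991, I.1.7] -/
theorem mapMatrix_constMatrix (M A : Matrix ι ι K) : (evalAtInvDet M).mapMatrix (constMatrix A) = A := by
  ext i j
  simp [constMatrix]

/-- The generic inverse evaluates to the inverse matrix (at a matrix with `det ≠ 0`; in fact always, both
sides being `Ring.inverse det • adj`). [cite: Borel1991, I.1.7] -/
theorem mapMatrix_genericInverse (M : Matrix ι ι K) : (evalAtInvDet M).mapMatrix (genericInverse ι K) = M⁻¹ := by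
  have hadj : (evalAtInvDet M).mapMatrix (genericMatrix ι K).adjugate = M.adjugate := by
    rw [RingHom.map_adjugate, mapMatrix_genericMatrix]
  rw [Matrix.inv_def, Ring.inverse_eq_inv', ← hadj]
  ext i j
  simp [genericInverse, Matrix.smul_apply]

/-- **Pull-back of closure membership along `x ↦ A·x·B·x⁻¹·C`** (`A, B, C` fixed matrices; a morphism
`GL_n → M_n` given by entries in `K[x_{ij}, 1/det]`): if `P(A s B s⁻¹ C) = 0` for all `s ∈ S`, then
`P(A f B f⁻¹ C) = 0` for every `f` in the entry-closure of `S` (all determinants non-zero).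
[cite: Borel1991, I.2.1 and I.2.4] -/
theorem eval_rationalConj_eq_zero_of_mem (b : Module.Basis ι K V) {S : Set (Module.End K V)}
    {f : Module.End K V} (hf : f ∈ zariskiClosureEndOfBasis b S)
    (hfdet : (LinearMap.toMatrix b b f).det ≠ 0) (hSdet : ∀ s ∈ S, (LinearMap.toMatrix b b s).det ≠ 0)
    (A B C : Matrix ι ι K) (P : MvPolynomial (ι × ι) K)
    (hP : ∀ s ∈ S, MvPolynomial.eval (fun ij : ι × ι =>
      (A * LinearMap.toMatrix b b s * B * (LinearMap.toMatrix b b s)⁻¹ * C) ij.1 ij.2) P = 0) :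
    MvPolynomial.eval (fun ij : ι × ι =>
      (A * LinearMap.toMatrix b b f * B * (LinearMap.toMatrix b b f)⁻¹ * C) ij.1 ij.2) P = 0 := by
  let E : Matrix ι ι (Polynomial (MvPolynomial (ι × ι) K)) :=
    constMatrix A * genericMatrix ι K * constMatrix B * genericInverse ι K * constMatrix C
  have hE : ∀ M : Matrix ι ι K, (evalAtInvDet M).mapMatrix E = A * M * B * M⁻¹ * C := by
    intro M
    simp only [E, map_mul, mapMatrix_constMatrix, mapMatrix_genericMatrix, mapMatrix_genericInverse]
  have hev : ∀ M : Matrix ι ι K, evalAtInvDet M (MvPolynomial.aeval (fun ij : ι × ι => E ij.1 ij.2) P) =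
      MvPolynomial.eval (fun ij : ι × ι => (A * M * B * M⁻¹ * C) ij.1 ij.2) P := by
    intro M
    rw [evalAtInvDet_aeval]
    refine congrArg (fun c => MvPolynomial.eval c P) (funext fun ij => ?_)
    rw [← hE M, RingHom.mapMatrix_apply, Matrix.map_apply]
  have h := evalAtInvDet_eq_zero_of_mem b hf hfdet hSdet (MvPolynomial.aeval (fun ij : ι × ι => E ij.1 ij.2) P)
    (fun s hs => by rw [hev]; exact hP s hs)
  rwa [hev] at h

end Rational

/-! ### §2 `Δ^Zar(K)` is a subgroup of `GL(V)` -/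

section Group

universe u v

variable {K : Type u} [Field K] {V : Type v} [AddCommGroup V] [Module K V] [Module.Finite K V]

omit [Module.Finite K V] in
/-- The matrix of an automorphism has non-zero determinant. [folklore] -/
private theorem det_toMatrix_ne_zero {ι : Type*} [Fintype ι] [DecidableEq ι] (b : Module.Basis ι K V)
    (g : V ≃ₗ[K] V) : (LinearMap.toMatrix b b (g : Module.End K V)).det ≠ 0 := by
  have h : LinearMap.toMatrix b b ((g⁻¹ : V ≃ₗ[K] V) : Module.End K V) * LinearMap.toMatrix b b (g : Module.End K V) = 1 := by
    rw [← LinearMap.toMatrix_mul, ← LinearEquiv.coe_toLinearMap_mul, inv_mul_cancel, LinearEquiv.coe_toLinearMap_one,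
      LinearMap.toMatrix_id]
  exact (Matrix.isUnit_det_of_left_inverse h).ne_zero

omit [Module.Finite K V] in
/-- The matrix of `g⁻¹` is the inverse matrix. [folklore] -/
private theorem toMatrix_inv {ι : Type*} [Fintype ι] [DecidableEq ι] (b : Module.Basis ι K V)
    (g : V ≃ₗ[K] V) :
    LinearMap.toMatrix b b ((g⁻¹ : V ≃ₗ[K] V) : Module.End K V) = (LinearMap.toMatrix b b (g : Module.End K V))⁻¹ := by
  refine (Matrix.inv_eq_left_inv ?_).symm
  rw [← LinearMap.toMatrix_mul, ← LinearEquiv.coe_toLinearMap_mul, inv_mul_cancel, LinearEquiv.coe_toLinearMap_one,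
    LinearMap.toMatrix_id]

/-- **The Zariski closure of a subgroup is closed under inversion** (Borel I.2.1 (a): "if `H` is a subgroup
of `G`, so is its closure"; here on `K`-points, through `x⁻¹ = adj(x)/det(x) ∈ M_n(K[x, 1/det])`).
[cite: Borel1991, I.2.1] [cite: CarlsonMullerStachPeters2017, Lemma–Definition 15.3.7] -/
theorem inv_mem_glZariskiClosure {Δ : Subgroup (V ≃ₗ[K] V)} {g : V ≃ₗ[K] V} (hg : g ∈ glZariskiClosure Δ) :
    g⁻¹ ∈ glZariskiClosure Δ := by
  classical
  let b := Module.Free.chooseBasis K V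
  rw [mem_glZariskiClosure_iff, ← zariskiClosureEnd_basis_indep b] at hg ⊢
  intro P hP
  -- pull back along the rational map `x ↦ x⁻¹ = adj(x)/det(x)` (`genericInverse`)
  have hSdet : ∀ s ∈ (fun h : V ≃ₗ[K] V => (h : Module.End K V)) '' (Δ : Set (V ≃ₗ[K] V)),
      (LinearMap.toMatrix b b s).det ≠ 0 := by
    rintro _ ⟨δ, _, rfl⟩
    exact det_toMatrix_ne_zero b δ
  -- the relation `P(y · adj x) = 0` holds on `Δ` (as `δ⁻¹ ∈ Δ`), hence at `g`
  have hev : ∀ x : V ≃ₗ[K] V, evalAtInvDet (LinearMap.toMatrix b b (x : Module.End K V))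
      (MvPolynomial.aeval (fun ij => genericInverse _ K ij.1 ij.2) P) =
      MvPolynomial.eval (fun ij => LinearMap.toMatrix b b ((x⁻¹ : V ≃ₗ[K] V) : Module.End K V) ij.1 ij.2) P := by
    intro x
    rw [evalAtInvDet_aeval, toMatrix_inv]
    refine congrArg (fun c => MvPolynomial.eval c P) (funext fun ij => ?_)
    rw [← mapMatrix_genericInverse, RingHom.mapMatrix_apply, Matrix.map_apply]
  have h := evalAtInvDet_eq_zero_of_mem b hg (det_toMatrix_ne_zero b g) hSdet
    (MvPolynomial.aeval (fun ij => genericInverse _ K ij.1 ij.2) P) (by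
      rintro _ ⟨δ, hδ, rfl⟩
      rw [hev]
      exact hP _ ⟨δ⁻¹, Δ.inv_mem hδ, rfl⟩)
  rwa [hev] at h

/-- The Zariski closure of a subgroup is closed under multiplication (the tree's
`mul_mem_zariskiClosureEndOfBasis`, restated for `glZariskiClosure`). [cite: Borel1991, I.2.1]
[cite: CarlsonMullerStachPeters2017, Lemma–Definition 15.3.7] -/
theorem mul_mem_glZariskiClosure {Δ : Subgroup (V ≃ₗ[K] V)} {g h : V ≃ₗ[K] V} (hg : g ∈ glZariskiClosure Δ)
    (hh : h ∈ glZariskiClosure Δ) : g * h ∈ glZariskiClosure Δ := by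
  classical
  let b := Module.Free.chooseBasis K V
  rw [mem_glZariskiClosure_iff, ← zariskiClosureEnd_basis_indep b] at hg hh ⊢
  rw [LinearEquiv.coe_toLinearMap_mul]
  refine mul_mem_zariskiClosureEndOfBasis b ?_ hg hh
  rintro _ ⟨x, hx, rfl⟩ _ ⟨y, hy, rfl⟩
  exact ⟨x * y, Δ.mul_mem hx hy, LinearEquiv.coe_toLinearMap_mul⟩

/-- `1 ∈ Δ^Zar`. [cite: CarlsonMullerStachPeters2017, Lemma–Definition 15.3.7] -/
theorem one_mem_glZariskiClosure (Δ : Subgroup (V ≃ₗ[K] V)) : (1 : V ≃ₗ[K] V) ∈ glZariskiClosure Δ :=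
  subset_glZariskiClosure Δ Δ.one_mem

/-- **`Δ^Zar(K)` as a subgroup of `GL(V)`** ("the smallest algebraic subgroup containing `Γ`", on
`K`-points). [cite: Borel1991, I.2.1] [cite: CarlsonMullerStachPeters2017, Lemma–Definition 15.3.7] -/
def glZariskiClosureSubgroup (Δ : Subgroup (V ≃ₗ[K] V)) : Subgroup (V ≃ₗ[K] V) where
  carrier := glZariskiClosure Δ
  one_mem' := one_mem_glZariskiClosure Δ
  mul_mem' := mul_mem_glZariskiClosure
  inv_mem' := inv_mem_glZariskiClosure

/-- [cite: CarlsonMullerStachPeters2017, Lemma–Definition 15.3.7] -/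
@[simp] theorem coe_glZariskiClosureSubgroup (Δ : Subgroup (V ≃ₗ[K] V)) :
    (glZariskiClosureSubgroup Δ : Set (V ≃ₗ[K] V)) = glZariskiClosure Δ := rfl

/-- [cite: CarlsonMullerStachPeters2017, Lemma–Definition 15.3.7] -/
theorem mem_glZariskiClosureSubgroup_iff (Δ : Subgroup (V ≃ₗ[K] V)) (g : V ≃ₗ[K] V) :
    g ∈ glZariskiClosureSubgroup Δ ↔ g ∈ glZariskiClosure Δ := Iff.rfl

/-- `Δ ≤ Δ^Zar` as subgroups. [cite: CarlsonMullerStachPeters2017, Lemma–Definition 15.3.7] -/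
theorem le_glZariskiClosureSubgroup (Δ : Subgroup (V ≃ₗ[K] V)) : Δ ≤ glZariskiClosureSubgroup Δ :=
  fun _ hg => subset_glZariskiClosure Δ hg

/-! ### §3 Commutators of closure points -/

/-- One conjugation step: for FIXED `c`, if `a c a⁻¹ c⁻¹ ∈ Δ` for all `a ∈ Δ₁` then `g c g⁻¹ c⁻¹ ∈ Δ^Zar`
for all `g ∈ Δ₁^Zar` (pull back along the rational map `x ↦ x · c · x⁻¹ · c⁻¹`). [cite: Borel1991, I.2.4] -/
theorem conj_commutator_mem_glZariskiClosure {Δ₁ Δ : Subgroup (V ≃ₗ[K] V)} {c : V ≃ₗ[K] V}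
    (h : ∀ a ∈ Δ₁, a * c * a⁻¹ * c⁻¹ ∈ glZariskiClosure Δ) {g : V ≃ₗ[K] V} (hg : g ∈ glZariskiClosure Δ₁) :
    g * c * g⁻¹ * c⁻¹ ∈ glZariskiClosure Δ := by
  classical
  let b := Module.Free.chooseBasis K V
  rw [mem_glZariskiClosure_iff, ← zariskiClosureEnd_basis_indep b] at hg
  rw [mem_glZariskiClosure_iff, ← zariskiClosureEnd_basis_indep b]
  intro P hP
  -- matrices of `x c x⁻¹ c⁻¹` as `1 · [x] · [c] · [x]⁻¹ · [c⁻¹]`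
  have hmat : ∀ x : V ≃ₗ[K] V, LinearMap.toMatrix b b ((x * c * x⁻¹ * c⁻¹ : V ≃ₗ[K] V) : Module.End K V) =
      1 * LinearMap.toMatrix b b (x : Module.End K V) * LinearMap.toMatrix b b (c : Module.End K V) *
        (LinearMap.toMatrix b b (x : Module.End K V))⁻¹ * LinearMap.toMatrix b b ((c⁻¹ : V ≃ₗ[K] V) : Module.End K V) := by
    intro x
    rw [Matrix.one_mul, ← toMatrix_inv, LinearEquiv.coe_toLinearMap_mul, LinearEquiv.coe_toLinearMap_mul,
      LinearEquiv.coe_toLinearMap_mul, LinearMap.toMatrix_mul, LinearMap.toMatrix_mul, LinearMap.toMatrix_mul]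
  have key := eval_rationalConj_eq_zero_of_mem b hg (det_toMatrix_ne_zero b g)
    (by rintro _ ⟨δ, _, rfl⟩; exact det_toMatrix_ne_zero b δ)
    1 (LinearMap.toMatrix b b (c : Module.End K V)) (LinearMap.toMatrix b b ((c⁻¹ : V ≃ₗ[K] V) : Module.End K V)) P
    (by
      rintro _ ⟨a, ha, rfl⟩
      rw [← hmat]
      -- `P` vanishes on `Δ`, hence on `Δ^Zar ∋ a c a⁻¹ c⁻¹`
      have hac := h a ha
      rw [mem_glZariskiClosure_iff, ← zariskiClosureEnd_basis_indep b] at hac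
      exact hac P hP)
  rw [← hmat] at key
  exact key

/-- **Commutators of closure points** (the two-step argument, Borel I.2.4): if `a c a⁻¹ c⁻¹ ∈ Δ` for all
`a ∈ Δ₁`, `c ∈ Δ₂`, then `g h g⁻¹ h⁻¹ ∈ Δ^Zar(K)` for all `g ∈ Δ₁^Zar(K)`, `h ∈ Δ₂^Zar(K)`.
[cite: Borel1991, I.2.4] -/
theorem commutator_mem_glZariskiClosure {Δ₁ Δ₂ Δ : Subgroup (V ≃ₗ[K] V)}
    (h : ∀ a ∈ Δ₁, ∀ c ∈ Δ₂, a * c * a⁻¹ * c⁻¹ ∈ Δ) {g h' : V ≃ₗ[K] V}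
    (hg : g ∈ glZariskiClosure Δ₁) (hh : h' ∈ glZariskiClosure Δ₂) :
    g * h' * g⁻¹ * h'⁻¹ ∈ glZariskiClosure Δ := by
  classical
  -- step 1: `g c g⁻¹ c⁻¹ ∈ Δ^Zar` for every `c ∈ Δ₂`
  have step1 : ∀ c ∈ Δ₂, g * c * g⁻¹ * c⁻¹ ∈ glZariskiClosure Δ :=
    fun c hc => conj_commutator_mem_glZariskiClosure (fun a ha => subset_glZariskiClosure Δ (h a ha c hc)) hg
  -- step 2: `x ↦ g x g⁻¹ x⁻¹ = (x g x⁻¹ g⁻¹)⁻¹`; apply step 1's shape to `Δ₂` with `c := g`, then invert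
  have step2 : h' * g * h'⁻¹ * g⁻¹ ∈ glZariskiClosure Δ := by
    refine conj_commutator_mem_glZariskiClosure (Δ₁ := Δ₂) (c := g) (fun c hc => ?_) hh
    -- `c g c⁻¹ g⁻¹ = (g c g⁻¹ c⁻¹)⁻¹`
    have hinv : c * g * c⁻¹ * g⁻¹ = (g * c * g⁻¹ * c⁻¹)⁻¹ := by group
    rw [hinv]
    exact inv_mem_glZariskiClosure (step1 c hc)
  have hinv : g * h' * g⁻¹ * h'⁻¹ = (h' * g * h'⁻¹ * g⁻¹)⁻¹ := by group
  rw [hinv]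
  exact inv_mem_glZariskiClosure step2

/-- **E2: `g, h ∈ Δ^Zar(K) ⇒ g h g⁻¹ h⁻¹ ∈ (⁅Δ, Δ⁆)^Zar(K)`** ("`⁅Zar Δ, Zar Δ⁆ ⊆ Zar ⁅Δ, Δ⁆` on
`K`-points"). [cite: Borel1991, I.2.4] -/
theorem commutator_mem_glZariskiClosure_commutator {Δ : Subgroup (V ≃ₗ[K] V)} {g h : V ≃ₗ[K] V}
    (hg : g ∈ glZariskiClosure Δ) (hh : h ∈ glZariskiClosure Δ) :
    g * h * g⁻¹ * h⁻¹ ∈ glZariskiClosure ⁅Δ, Δ⁆ :=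
  commutator_mem_glZariskiClosure (fun a ha c hc => by
    rw [← commutatorElement_def]; exact Subgroup.commutator_mem_commutator ha hc) hg hh

/-- **Stripping a central factor**: if `Δ ≤ Δ'` and every element of `Δ'` is `δ z` with `δ ∈ Δ` and `z`
central in `GL(V)` (e.g. `Δ' = Γ · U(1)`, the unit scalars), then commutators of points of `(Δ')^Zar`
lie in `Δ^Zar` — `[δ z, δ' z'] = [δ, δ'] ∈ Δ`. This is how a density statement modulo the centre
(Carlson–Toledo §7: "`PΓ` Zariski-dense in `PU(p,q)`", typed as `U(h) ⊆ (Γ·U(1))^Zar`) yields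
`[U(h), U(h)] ⊆ Γ^Zar`. [cite: Borel1991, I.2.4] [cite: CarlsonToledo1999, §7 Theorem udensitytheo] -/
theorem commutator_mem_glZariskiClosure_of_mul_central {Δ Δ' : Subgroup (V ≃ₗ[K] V)}
    (hΔ' : ∀ x ∈ Δ', ∃ δ ∈ Δ, ∃ z : V ≃ₗ[K] V, (∀ y : V ≃ₗ[K] V, z * y = y * z) ∧ x = δ * z)
    {g h : V ≃ₗ[K] V} (hg : g ∈ glZariskiClosure Δ') (hh : h ∈ glZariskiClosure Δ') :
    g * h * g⁻¹ * h⁻¹ ∈ glZariskiClosure Δ := by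
  refine commutator_mem_glZariskiClosure (fun a ha c hc => ?_) hg hh
  obtain ⟨δ, hδ, z, hz, rfl⟩ := hΔ' a ha
  obtain ⟨δ', hδ', z', hz', rfl⟩ := hΔ' c hc
  have : δ * z * (δ' * z') * (δ * z)⁻¹ * (δ' * z')⁻¹ = δ * δ' * δ⁻¹ * δ'⁻¹ := by
    simp only [mul_inv_rev, ← mul_assoc]
    -- `δ z δ' z' z⁻¹ δ⁻¹ z'⁻¹ δ'⁻¹ = δ δ' δ⁻¹ δ'⁻¹`, moving the central `z`, `z'` next to their inverses
    rw [mul_assoc δ z δ', hz δ', ← mul_assoc, mul_assoc (δ * δ') z z', hz z', ← mul_assoc,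
      mul_assoc (δ * δ' * z') z z⁻¹, mul_inv_cancel, mul_one, mul_assoc (δ * δ') z' δ⁻¹, hz' δ⁻¹, ← mul_assoc,
      mul_assoc (δ * δ' * δ⁻¹) z' z'⁻¹, mul_inv_cancel, mul_one]
  rw [this]
  exact Δ.mul_mem (Δ.mul_mem (Δ.mul_mem hδ hδ') (Δ.inv_mem hδ)) (Δ.inv_mem hδ')

end Group

end Literature.AlgebraicGeometry.HodgeTheory

end
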